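import Summits.AtomisticToContinuum.BoseEinsteinCondensation.Theorems.BECGroundStateSOSPeriodicIRBoundDefs
import Summits.AtomisticToContinuum.BoseEinsteinCondensation.Theorems.BECGroundStateSOSPeriodicIRBoundLinearFloorOfLandau
import Summits.AtomisticToContinuum.BoseEinsteinCondensation.Theorems.BECGroundStateSOSPeriodicIRBoundTransferArith
import Summits.AtomisticToContinuum.BoseEinsteinCondensation.Theorems.BECGroundStateSOSPeriodicIRBoundHardCoreHalf
import Summits.AtomisticToContinuum.BoseEinsteinCondensation.Theorems.BECGroundStateSOSPeriodicIRBoundWFAssembly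
import Summits.AtomisticToContinuum.BoseEinsteinCondensation.Theorems.PeriodicIRBound.Negative.HardCoreScope
import HarnessLib

/-!
# Route `BECGroundStateSOS`, crux `PeriodicIRBound` (stmt-AtomisticToContinuum-3972),
# line `linear-ph-floor-wagner` — the sorry-free REDUCTION of the crux to its open inputs

With the line's own stubs 4 (`stub_linearFloor_of_landau`, `…LinearFloorOfLandau`), 5b
(`stub_wagnerFeynman`, `…WFAssembly` + 19 `WF*` modules), 5c (`stub_transferArith`, `…TransferArith`) and 6
(`stub_hardCore`, `…HardCoreHalf`) landed, the composition `periodicIRBound_of_inputs` of the Defs module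
specialises to importable, sorry-free implications recording exactly what the crux still rests on:

* per potential, INTEGRABLE `v` (`∫ v(|x|)dx < ∞`): the linear particle–hole floor `C⁺(v)` (needed only when
  `∫v ≠ 0`) and the fixed-`(N,L)` zero-momentum gap give `IRBoundFor v` (`irBoundFor_of_linearFloor_of_gap`);
* per potential, NON-INTEGRABLE `v` (`∫v = ⊤`): `C⁺(v)` and the hard-core moment bound (stub 6b's shape) give
  `IRBoundFor v` (`irBoundFor_of_linearFloor_of_hardCoreWF`);
* globally: the integrable half of the crux (Disproof §19, `periodicIRBound_iff_split`) follows from the three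
  POOLED sibling items alone — stmt-9091 `LandauSectorBound`, stmt-9094 `EnergyConvexityWindow`, stmt-11845
  `ZeroMomentumGround` (`integrableHalf_of_pooled`); the non-integrable half from stmt-9091, stmt-9094 and the one
  open own stub 6b `HardCoreWagnerFeynmanBound` (`nonIntegrableHalf_of_pooled`); and the crux BY NAME from the
  four of them (`stub_reduction`, registered on the crux item as the line's by-product sub-goal).

No new definitions; pure composition over landed theorems. References: H. Wagner, Z. Physik 195 (1966) 273;
S. Stringari, in *Bose–Einstein Condensation* (CUP 1995) §2.2; L. Pitaevskii, S. Stringari, J. Low Temp. Phys.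
85 (1991) 377.
-/

noncomputable section

open scoped BigOperators ENNReal
open Filter MeasureTheory

namespace Summit.AtomisticToContinuum.BoseEinsteinCondensation.Cruxes.PeriodicIRBound.LinearPhFloorWagner

open Literature.MathematicalPhysics.QuantumManyBody.BoseGas
open Summit.AtomisticToContinuum.BoseEinsteinCondensation.Theses.BECGroundStateSOS (PeriodicIRBound)
open Summit.AtomisticToContinuum.BoseEinsteinCondensation.Theses.BECSectorPoincareTwoScale
  (LandauSectorBound EnergyConvexityWindow)
open Summit.AtomisticToContinuum.BoseEinsteinCondensation.Theses.BECNoCheapMomentum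
  (ZeroMomentumGround SectorGapFloor)
open Summit.AtomisticToContinuum.BoseEinsteinCondensation.Theorems.PeriodicIRBound.Negative
  (IRBoundFor groundOccupation GroundIRBoundWith irBoundFor_iff_ground periodicIRBound_iff
    periodicIRBound_iff_split)

/-! ## Per-potential reductions (no pooled item involved) -/

/-- **Integrable potentials, per `v`.** For an integrable admissible `v`, the linear particle–hole floor
`C⁺(v)` (only needed when `∫v ≠ 0`; the a.e.-free case is the free gas) together with the fixed-`(N,L)`
zero-momentum gap `E₀^per(N,L) < E^per_N(q;L)` (`q ≠ 0`) implies the crux's infrared bound for `v` — the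
two-sided Wagner–Feynman moment inequality with `A = 2` (landed stub 5b) and the window arithmetic (landed
stub 5c). [folklore] -/
theorem irBoundFor_of_linearFloor_of_gap (v : ℝ → ℝ≥0∞) (hv : IsRepulsiveFiniteRange v)
    (hint : (∫⁻ x : Space, v ‖x‖) ≠ ⊤) (hfloor : (∫⁻ x : Space, v ‖x‖) ≠ 0 → LinearFloorFor v)
    (hgap : ZeroMomentumGapFor v) : IRBoundFor v :=
  (irBoundFor_iff_ground v).2 (transfer_of stub_wagnerFeynman stub_transferArith v hv hint hfloor hgap)

/-- **Non-integrable potentials, per `v`.** For an admissible `v` with `∫v = ⊤` (hard cores, non-`L¹`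
spikes), the linear particle–hole floor `C⁺(v)` together with the hard-core moment bound of stub 6b's shape
(`HardCoreWagnerFeynmanWith v C A ρ₁` for every window constant `C`) implies the crux's infrared bound for
`v` (landed stub 6, window arithmetic). [folklore] -/
theorem irBoundFor_of_linearFloor_of_hardCoreWF (v : ℝ → ℝ≥0∞) (hv : IsRepulsiveFiniteRange v)
    (htop : (∫⁻ x : Space, v ‖x‖) = ⊤)
    (hwf : ∀ C : ℝ, 0 < C → ∃ A : ℝ, 0 < A ∧ ∃ ρ₁ : ℝ, 0 < ρ₁ ∧ HardCoreWagnerFeynmanWith v C A ρ₁)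
    (hfloor : LinearFloorFor v) : IRBoundFor v :=
  (irBoundFor_iff_ground v).2 (stub_hardCore v hv htop hwf hfloor)

/-! ## Global reductions to the pooled sibling items -/

/-- `C⁺` for every admissible `v` with `∫v ≠ 0`, from stmt-9091 and stmt-9094 (landed stub 4). [folklore] -/
theorem linearParticleHoleFloor_of_pooled (h₁ : LandauSectorBound) (h₂ : EnergyConvexityWindow) :
    LinearParticleHoleFloor :=
  stub_linearFloor_of_landau h₂ h₁

/-- **The INTEGRABLE half of the crux from the three pooled items alone**: stmt-9091 `LandauSectorBound`,
stmt-9094 `EnergyConvexityWindow`, stmt-11845 `ZeroMomentumGround` imply `IRBoundFor v` for every integrable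
admissible `v` — no own stub of the line remains on this half. [folklore] -/
theorem integrableHalf_of_pooled (h₁ : LandauSectorBound) (h₂ : EnergyConvexityWindow)
    (h₃ : ZeroMomentumGround) :
    ∀ v : ℝ → ℝ≥0∞, IsRepulsiveFiniteRange v → (∫⁻ x : Space, v ‖x‖) ≠ ⊤ → IRBoundFor v :=
  fun v hv hint =>
    irBoundFor_of_linearFloor_of_gap v hv hint (linearParticleHoleFloor_of_pooled h₁ h₂ v hv)
      (fun N L hL q hq => h₃ v hv hint N L hL q hq)

/-- **The NON-INTEGRABLE half of the crux** from stmt-9091, stmt-9094 and the one open own stub 6b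
`HardCoreWagnerFeynmanBound` (the dressed per-mode moment bound). [folklore] -/
theorem nonIntegrableHalf_of_pooled (h₁ : LandauSectorBound) (h₂ : EnergyConvexityWindow)
    (h₈ : HardCoreWagnerFeynmanBound) :
    ∀ v : ℝ → ℝ≥0∞, IsRepulsiveFiniteRange v → (∫⁻ x : Space, v ‖x‖) = ⊤ → IRBoundFor v :=
  fun v hv htop =>
    irBoundFor_of_linearFloor_of_hardCoreWF v hv htop (h₈ v hv htop)
      (linearParticleHoleFloor_of_pooled h₁ h₂ v hv (ne_of_eq_of_ne htop ENNReal.top_ne_zero))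

/-- **Registered by-product sub-goal `stub_reduction`: the crux `PeriodicIRBound` BY NAME from its four open
inputs** — the pooled sibling items stmt-9091, stmt-9094, stmt-11845 and the own stub 6b — all other stubs of
the line being landed theorems (`periodicIRBound_iff_split`: integrable half + non-integrable half). [folklore] -/
theorem stub_reduction : LandauSectorBound → EnergyConvexityWindow → ZeroMomentumGround →
    HardCoreWagnerFeynmanBound → PeriodicIRBound :=
  fun h₁ h₂ h₃ h₈ =>
    periodicIRBound_iff_split.2 ⟨integrableHalf_of_pooled h₁ h₂ h₃, nonIntegrableHalf_of_pooled h₁ h₂ h₈⟩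

/-- The same reduction through the Defs module's eight-input composition, as a cross-check that the two
book-keepings agree. [folklore] -/
theorem periodicIRBound_of_open_inputs (h₁ : LandauSectorBound) (h₂ : EnergyConvexityWindow)
    (h₃ : ZeroMomentumGround) (h₈ : HardCoreWagnerFeynmanBound) : PeriodicIRBound :=
  periodicIRBound_of_inputs h₁ h₂ h₃ stub_linearFloor_of_landau stub_wagnerFeynman stub_transferArith
    stub_hardCore h₈

end Summit.AtomisticToContinuum.BoseEinsteinCondensation.Cruxes.PeriodicIRBound.LinearPhFloorWagner

end
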